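import Literature.MathematicalPhysics.QuantumFieldTheory.BalabanImbrieJaffe1984to88.BIJ88LocatedActivityBound309
import Literature.MathematicalPhysics.QuantumFieldTheory.BalabanImbrieJaffe1984to88.BIJ88SlotDriftLetter309

/-!
# `BalabanImbrieJaffe1984to88.BIJ88LocatedActivityBoundSizeFree309` — T. Bałaban, J. Imbrie, A. Jaffe, *Effective action and cluster properties
of the abelian Higgs model*, Commun. Math. Phys. **114** (1988) 257–315 [BalabanImbrieJaffe1988]: p. 307 [PDF 51] L4–13 (Sect. 5.13), verbatim:
*"Functional derivatives hitting χ-factors farther than ½r(e_k) from Λ₁₀^{(k)c} produce factors e^{−cp(e_k)²} after integrating with respect to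
A^{(k)″}, φ^{(k)″}. … (here we use the fact that the translation vanishes). … Functional derivatives hitting χ′-factors within ½r(e_k) of Λ₁₀^{(k)c}
are connected through C_ω(α) to Λ₁₁^{(k)}, so we get small factors e^{−cr(e_k)} from the exponential decay of the operators C_s and Δ in C_ω(α)"*,
and p. 309 [PDF 53] ((5.14.4): *"The proof of this estimate is similar to the one for g₂"*) — **THE MASTER BOUND OF THE LOCATED (5.14.4) WITHOUT
THE TOTAL SOURCE MASS `‖ℱ|_X″‖₂`**.

`BIJ88LocatedActivityBound309.abs_actIn_le_master` carries the Gaussian shells `2e^{−a_b(a_b − 2ΛF/m)/(2Λ²/m)}` with `‖ℱ|_X″‖₂ ≤ F` — the TOTAL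
ℓ²-mass of the source on the region, not uniform in `|X″|` (owner pre-filing review v2.386 of the size-free located (5.14.4), road (α)).  Here
the same three steps (E4c sharp term bound, certified train ends, the walk form) are re-run on the per-slot shell bound of
`BIJ88SlotDriftLetter309` — the mean of each slot field enters ITS OWN shell, and is bounded by the size-free drift `Λ_∞(2/m)F₀Z` from the decay
of `(Δ_s|_X″)⁻¹`, the sitewise source and the site lattice sum:
* `abs_gexp_trains_obs_le_hit_local` — `BIJ88TermHitShellBound309.abs_gexp_trains_obs_le_hit` with a drift letter per located χ-slot;
* `abs_gexp_trains_fD_uD_le_of_cert_local` — `BIJ88LocatedActivityBound309.abs_gexp_trains_fD_uD_le_of_cert` likewise;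
* **`abs_actIn_le_master_sizeFree`** — THE MASTER BOUND with the shells `2e^{−a_b(a_b − 2Λ_∞(2/m)F₀Z)/(2Λ²/m)}`: hypotheses as the master bound
  with `(F, ‖ℱ|_X″‖₂ ≤ F)` REPLACED by the `Δ`-letters (site pseudometric `d`, band, off-diagonal size `h`, local volume `z`, rate `μ`,
  `hz(e^μ−1) ≤ m/2`), a sitewise bound `|ℱ| ≤ F₀` on the sites of `X″`, the site lattice sum `Z` (rate `μ/2`) and the ℓ^∞ slot letter `Λ_∞` —
  every one of them independent of `|X″|`.

statement-level skeleton of published theorems with citation tags; proofs where landed; nothing here is a claim about the Yang–Mills mass gap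

PDF held: `paper:balaban1988-cmp114-bij-abelian-higgs-effective-action` pp. 307, 309 (p0051 L4–13, p0053 L12–15) re-read this session as text.

CITATION HEADER (lean-in-tree rule).  Part of the lit-balaban TYPED SKELETON (HOME `run/shared/lean/pub/lit-balaban/`), Phase 2, seat p36
(gen 23, unit `lit-balaban-p36`); rows **C2.Eq5.14.3-5.14.4** (member: road (α) — the master bound feeding the size-free instance) and
C2.Eq5.13.3-5.13.4 (member) of `HOME/lit-balaban-r16/ROWS-C2-part2.md` (owner r16, referee ref-5).  Theorem-only; no definitions, no `Prop`
facts; axioms standard.  HONEST SCOPE: as `BIJ88LocatedActivityBound309` (every size a letter; Gevrey/all-orders slot letters as inputs; linear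
χ-slot fields; a site in `X″`) with the source class now sitewise-bounded instead of ℓ²-bounded on the region.  NOT summit progress; NOT
continuum; NOT Clay.
-/

namespace Literature.MathematicalPhysics.QuantumFieldTheory.BalabanImbrieJaffe1984to88.BIJ88LocatedActivityBoundSizeFree309

open Finset Matrix
open scoped BigOperators
open Literature.Probability.LatticeModels (setPartitions)
open BIJ88Sect5Statements (CutoffProfile)
open BIJ88DirichletForms305 (interpForm)
open BIJ88PairingAllOrders5133 (smallParts)
open BIJ88WickSourceSmooth305 (dset)
open BIJ88SmoothFactors5133 (CbInf)
open BIJ88TrainPieces306 (wker)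
open BIJ88WalkForm5133 (trains)
open BIJ88TrainsDsetExpansion306 (trainCoef trainLegs trainSite)
open BIJ88TrainTermBound307 (abs_trainCoef_le mul_indicator_le_mul_indicator_of_subset)
open BIJ88TruncationConnected306 (gexp)
open BIJ88TruncationConnected5133 (bmat)
open BIJ88PolymerRep5134 (corner)
open BIJ88PolymerRep5134Gauss (obs prec src ext)
open BIJ88Expansion5143Gauss (fD)
open BIJ88SlotMomentsGauss308 (uD)
open BIJ88Eq5145CornerModel (slotB slotY)
open BIJ88Eq5145CornerUrsell (cubeIn)
open BIJ88W6PrimeVsupp (actIn)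
open BIJ88TermHitShellBound309 (abs_trains_obs_le_sum_indicator)
open BIJ88ActivityWalkBound309 (abs_actIn_le_sum)
open BIJ88LocatedActivityBound309 (sum_elim_nonneg)
open BIJ88SlotDriftLetter309 (abs_slotField_drift_le abs_gexp_prec_le_sum_shell_local)

variable {α I : Type} [Fintype α] [DecidableEq α] [Fintype I] [DecidableEq I] (blk : α → I) (Δ : Matrix α α ℝ) (ℱ : α → ℝ)
variable (χ : CutoffProfile) {ι υ : Type} [DecidableEq ι] [DecidableEq υ] (p : ℝ) {ek t : ℝ} (B : Finset ι)
  {Φ : ι → (α → ℝ) → ℝ} {c : ι → ℝ} (Ys : Finset υ) {V : υ → (α → ℝ) → ℝ} (cube : ↥B ⊕ ↥Ys → I) {L : Type*} (γ : L → ↥B ⊕ ↥Ys)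

/-! ## §1  The sharp term bound with a drift letter per located χ-slot -/

/-- **ONE TRAIN EXPECTATION, SHARP FORM, LOCAL DRIFTS** — `BIJ88TermHitShellBound309.abs_gexp_trains_obs_le_hit` with the source entering the
shells through the drift letter `|Φ_b(ext((prec blk Δ X s)⁻¹(src blk ℱ X)))| ≤ D` per located χ-slot instead of `‖ℱ|_X‖₂ ≤ F`.
[cite: BalabanImbrieJaffe1988, §5.13 p.307 L4–13, (5.14.4) p.309] -/
theorem abs_gexp_trains_obs_le_hit_local (X : Finset I) (hΔ : Δ.PosDef) {m : ℝ} (hm : 0 < m) (hΔm : ∀ φ : α → ℝ, m * (φ ⬝ᵥ φ) ≤ φ ⬝ᵥ (Δ *ᵥ φ))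
    {s : I → ℝ} (hs : ∀ i, 0 ≤ s i ∧ s i ≤ 1)
    (hek : 0 < ek) (ht : 0 < t) (h1 : t * ek < 1) (hΦ : ∀ b ∈ B, IsLinearMap ℝ (Φ b)) (hc : ∀ b ∈ B, c b ≠ 0)
    (hV : ∀ Y ∈ Ys, CbInf (V Y)) (K : Finset L) (τ₀ : ↥B ⊕ ↥Ys) {Λ : ℝ} (hΛ : 0 < Λ)
    (hframe : ∀ (θ : ↥(univ.filter fun b : ↥B => cube (Sum.inl b) ∈ X) → ℝ) (φ : α → ℝ),
      |∑ b, θ b * Φ b.1.1 φ| ≤ Λ * Real.sqrt (∑ b, θ b ^ 2) * Real.sqrt (φ ⬝ᵥ φ))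
    {Dr : ℝ} (hD : ∀ b : ↥(univ.filter fun b : ↥B => cube (Sum.inl b) ∈ X),
      |Φ b.1.1 (ext blk X ((prec blk Δ X s)⁻¹ *ᵥ src blk ℱ X))| ≤ Dr) {a a' : ↥B → ℝ} (ha : ∀ b, 0 ≤ a b)
    (C : Matrix (BIJ88PolymerRep5134Gauss.Site blk X) (BIJ88PolymerRep5134Gauss.Site blk X) ℝ)
    (N : Finset I → Matrix (BIJ88PolymerRep5134Gauss.Site blk X) (BIJ88PolymerRep5134Gauss.Site blk X) ℝ)
    (Lt : List (Finset (Finset I)))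
    {A : ↥B ⊕ ↥Ys → ℕ → ℕ → ℝ} (hA : ∀ τ m n, 0 ≤ A τ m n) (hA1 : ∀ b : ↥B, 1 ≤ A (Sum.inl b) 0 0)
    {w : ↥B ⊕ ↥Ys → BIJ88PolymerRep5134Gauss.Site blk X → ℝ} (hw : ∀ τ x, 0 ≤ w τ x)
    (hχ : ∀ (q : Fin Lt.length ×ₗ Fin 2 → BIJ88PolymerRep5134Gauss.Site blk X) (b : ↥B) (m : ℕ) (D' : Finset (Fin Lt.length ×ₗ Fin 2))
      (φ : BIJ88PolymerRep5134Gauss.Site blk X → ℝ), (m ≠ 0 ∨ D'.card ≠ 0) →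
      |dset (fun j => Pi.single (q j) (1 : ℝ)) D' (fun ψ => uD χ p ek B Φ c Ys V t (Sum.inl b) m (ext blk X ψ)) φ| ≤
        A (Sum.inl b) m D'.card * (∏ j ∈ D', w (Sum.inl b) (q j)) *
          Set.indicator (Set.Icc (a b) (a' b)) (fun _ => (1 : ℝ)) |Φ b (ext blk X φ)|)
    (hY : ∀ (q : Fin Lt.length ×ₗ Fin 2 → BIJ88PolymerRep5134Gauss.Site blk X) (Y : ↥Ys) (m : ℕ) (D' : Finset (Fin Lt.length ×ₗ Fin 2))
      (φ : BIJ88PolymerRep5134Gauss.Site blk X → ℝ),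
      |dset (fun j => Pi.single (q j) (1 : ℝ)) D' (fun ψ => uD χ p ek B Φ c Ys V t (Sum.inr Y) m (ext blk X ψ)) φ| ≤
        A (Sum.inr Y) m D'.card * ∏ j ∈ D', w (Sum.inr Y) (q j)) :
    |gexp (prec blk Δ X s) (src blk ℱ X) (trains (src blk ℱ X) C N Lt (obs blk (fD (uD χ p ek B Φ c Ys V t) cube γ K) X))| ≤
      ∑ E : Fin Lt.length → BIJ88PolymerRep5134Gauss.Site blk X ⊕
          (BIJ88PolymerRep5134Gauss.Site blk X × BIJ88PolymerRep5134Gauss.Site blk X),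
        ∑ g ∈ Fintype.piFinset (fun j => if j ∈ trainLegs E then univ.filter (fun τ => cube τ ∈ X) else {τ₀}),
          |trainCoef (src blk ℱ X) (fun k => C * wker C N (Lt.get k)) E| *
            (∏ τ ∈ univ.filter (fun τ => cube τ ∈ X),
              (A τ (K.filter fun j => γ j = τ).card ((trainLegs E).filter fun j => g j = τ).card *
                ∏ j ∈ (trainLegs E).filter (fun j => g j = τ), w τ (trainSite E j))) *
            ∏ b ∈ (univ.filter fun b : ↥B => cube (Sum.inl b) ∈ X).attach.filter (fun b =>
                (K.filter fun j => γ j = Sum.inl b.1).card ≠ 0 ∨ ((trainLegs E).filter fun j => g j = Sum.inl b.1).card ≠ 0),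
              2 * Real.exp (-(a b.1 * (a b.1 - 2 * Dr) / (2 * (Λ ^ 2 / m)))) := by
  classical
  -- index the terms by the pairs `(E, g)` and integrate with `BIJ88SlotDriftLetter309.abs_gexp_prec_le_sum_shell_local`
  have h := abs_gexp_prec_le_sum_shell_local blk Δ ℱ hΔ hm hΔm hs X (B₀ := univ.filter fun b : ↥B => cube (Sum.inl b) ∈ X)
    (Φ := fun b : ↥B => Φ b) (fun b _ => hΦ b.1 b.2) hΛ hframe (Dr := fun _ => Dr) (fun b => hD b)
    (a := fun b : ↥(univ.filter fun b : ↥B => cube (Sum.inl b) ∈ X) => a b.1) (fun b => ha b.1)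
    ((univ : Finset (Fin Lt.length → BIJ88PolymerRep5134Gauss.Site blk X ⊕
        (BIJ88PolymerRep5134Gauss.Site blk X × BIJ88PolymerRep5134Gauss.Site blk X))).sigma
      fun E => Fintype.piFinset (fun j => if j ∈ trainLegs E then univ.filter (fun τ => cube τ ∈ X) else {τ₀}))
    (fun Eg => (univ.filter fun b : ↥B => cube (Sum.inl b) ∈ X).attach.filter fun b =>
      (K.filter fun j => γ j = Sum.inl b.1).card ≠ 0 ∨ ((trainLegs Eg.1).filter fun j => Eg.2 j = Sum.inl b.1).card ≠ 0)
    (M := fun Eg => |trainCoef (src blk ℱ X) (fun k => C * wker C N (Lt.get k)) Eg.1| *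
      ∏ τ ∈ univ.filter (fun τ => cube τ ∈ X),
        (A τ (K.filter fun j => γ j = τ).card ((trainLegs Eg.1).filter fun j => Eg.2 j = τ).card *
          ∏ j ∈ (trainLegs Eg.1).filter (fun j => Eg.2 j = τ), w τ (trainSite Eg.1 j)))
    (fun Eg _ => mul_nonneg (abs_nonneg _) (prod_nonneg fun τ _ => mul_nonneg (hA _ _ _) (prod_nonneg fun j _ => hw _ _)))
    (G := trains (src blk ℱ X) C N Lt (obs blk (fD (uD χ p ek B Φ c Ys V t) cube γ K) X)) fun ω => ?_
  · rw [sum_sigma] at h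
    exact h
  · -- the pointwise bound of §3, rewritten as a sum over the pairs and with the event in the sub-family form
    rw [sum_sigma]
    refine (abs_trains_obs_le_sum_indicator blk X χ p B Ys cube γ hek ht h1 hΦ hc hV K τ₀ (src blk ℱ X) C N Lt hA hA1 hw hχ hY ω).trans
      (sum_le_sum fun E _ => sum_le_sum fun g _ => mul_indicator_le_mul_indicator_of_subset (fun ψ hψ => ?_)
        (mul_nonneg (abs_nonneg _) (prod_nonneg fun τ _ => mul_nonneg (hA _ _ _) (prod_nonneg fun j _ => hw _ _))) ω)
    intro b hb
    obtain ⟨-, hb'⟩ := mem_filter.1 hb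
    exact hψ b.1 (mem_filter.1 b.2).2 hb'

/-! ## §2  Certified train ends -/

/-- **ONE TRAIN EXPECTATION WITH CERTIFIED TRAIN-END SIZES, LOCAL DRIFTS** — `BIJ88LocatedActivityBound309.abs_gexp_trains_fD_uD_le_of_cert`
with the drift letter per located χ-slot. [cite: BalabanImbrieJaffe1988, §5.13 p.307, (5.14.4) p.309] -/
theorem abs_gexp_trains_fD_uD_le_of_cert_local (X : Finset I) (hΔ : Δ.PosDef) {m : ℝ} (hm : 0 < m)
    (hΔm : ∀ φ : α → ℝ, m * (φ ⬝ᵥ φ) ≤ φ ⬝ᵥ (Δ *ᵥ φ)) {s : I → ℝ} (hs : ∀ i, 0 ≤ s i ∧ s i ≤ 1)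
    (hek : 0 < ek) (ht : 0 < t) (h1 : t * ek < 1) (hΦ : ∀ b ∈ B, IsLinearMap ℝ (Φ b)) (hc : ∀ b ∈ B, c b ≠ 0)
    (hV : ∀ Y ∈ Ys, CbInf (V Y)) (K : Finset L) (τ₀ : ↥B ⊕ ↥Ys) {Λ : ℝ} (hΛ : 0 < Λ)
    (hframe : ∀ (θ : ↥(univ.filter fun b : ↥B => cube (Sum.inl b) ∈ X) → ℝ) (φ : α → ℝ),
      |∑ b, θ b * Φ b.1.1 φ| ≤ Λ * Real.sqrt (∑ b, θ b ^ 2) * Real.sqrt (φ ⬝ᵥ φ))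
    {Dr : ℝ} (hD : ∀ b : ↥(univ.filter fun b : ↥B => cube (Sum.inl b) ∈ X),
      |Φ b.1.1 (ext blk X ((prec blk Δ X s)⁻¹ *ᵥ src blk ℱ X))| ≤ Dr) {a a' : ↥B → ℝ} (ha : ∀ b, 0 ≤ a b)
    (N : Finset I → Matrix (BIJ88PolymerRep5134Gauss.Site blk X) (BIJ88PolymerRep5134Gauss.Site blk X) ℝ)
    (Lt : List (Finset (Finset I)))
    {A : ↥B ⊕ ↥Ys → ℕ → ℕ → ℝ} (hA : ∀ τ m n, 0 ≤ A τ m n) (hA1 : ∀ b : ↥B, 1 ≤ A (Sum.inl b) 0 0)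
    {w : ↥B ⊕ ↥Ys → BIJ88PolymerRep5134Gauss.Site blk X → ℝ} (hw : ∀ τ x, 0 ≤ w τ x)
    (hχ : ∀ (q : Fin Lt.length ×ₗ Fin 2 → BIJ88PolymerRep5134Gauss.Site blk X) (b : ↥B) (m : ℕ) (D' : Finset (Fin Lt.length ×ₗ Fin 2))
      (φ : BIJ88PolymerRep5134Gauss.Site blk X → ℝ), (m ≠ 0 ∨ D'.card ≠ 0) →
      |dset (fun j => Pi.single (q j) (1 : ℝ)) D' (fun ψ => uD χ p ek B Φ c Ys V t (Sum.inl b) m (ext blk X ψ)) φ| ≤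
        A (Sum.inl b) m D'.card * (∏ j ∈ D', w (Sum.inl b) (q j)) *
          Set.indicator (Set.Icc (a b) (a' b)) (fun _ => (1 : ℝ)) |Φ b (ext blk X φ)|)
    (hY : ∀ (q : Fin Lt.length ×ₗ Fin 2 → BIJ88PolymerRep5134Gauss.Site blk X) (Y : ↥Ys) (m : ℕ) (D' : Finset (Fin Lt.length ×ₗ Fin 2))
      (φ : BIJ88PolymerRep5134Gauss.Site blk X → ℝ),
      |dset (fun j => Pi.single (q j) (1 : ℝ)) D' (fun ψ => uD χ p ek B Φ c Ys V t (Sum.inr Y) m (ext blk X ψ)) φ| ≤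
        A (Sum.inr Y) m D'.card * ∏ j ∈ D', w (Sum.inr Y) (q j))
    {κc : Finset (Finset I) → BIJ88PolymerRep5134Gauss.Site blk X → BIJ88PolymerRep5134Gauss.Site blk X → ℝ}
    (hκ : ∀ (cg : Finset (Finset I)) (x y : BIJ88PolymerRep5134Gauss.Site blk X),
      |((prec blk Δ X s)⁻¹ * wker (prec blk Δ X s)⁻¹ N cg) x y| ≤ κc cg x y)
    {Fq : BIJ88PolymerRep5134Gauss.Site blk X → ℝ} (hFq : ∀ q : BIJ88PolymerRep5134Gauss.Site blk X, |ℱ q.1| ≤ Fq q) :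
    |gexp (prec blk Δ X s) (src blk ℱ X)
        (trains (src blk ℱ X) (prec blk Δ X s)⁻¹ N Lt (obs blk (fD (uD χ p ek B Φ c Ys V t) cube γ K) X))| ≤
      ∑ E : Fin Lt.length → BIJ88PolymerRep5134Gauss.Site blk X ⊕
          (BIJ88PolymerRep5134Gauss.Site blk X × BIJ88PolymerRep5134Gauss.Site blk X),
        ∑ g ∈ Fintype.piFinset (fun j => if j ∈ trainLegs E then univ.filter (fun τ => cube τ ∈ X) else {τ₀}),
          (∏ k, Sum.elim (fun x => ∑ y, κc (Lt.get k) x y * Fq y) (fun xy => (1 / 2 : ℝ) * κc (Lt.get k) xy.1 xy.2) (E k)) *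
            (∏ τ ∈ univ.filter (fun τ => cube τ ∈ X),
              (A τ (K.filter fun j => γ j = τ).card ((trainLegs E).filter fun j => g j = τ).card *
                ∏ j ∈ (trainLegs E).filter (fun j => g j = τ), w τ (trainSite E j))) *
            ∏ b ∈ (univ.filter fun b : ↥B => cube (Sum.inl b) ∈ X).attach.filter (fun b =>
                (K.filter fun j => γ j = Sum.inl b.1).card ≠ 0 ∨ ((trainLegs E).filter fun j => g j = Sum.inl b.1).card ≠ 0),
              2 * Real.exp (-(a b.1 * (a b.1 - 2 * Dr) / (2 * (Λ ^ 2 / m)))) := by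
  refine (abs_gexp_trains_obs_le_hit_local blk Δ ℱ χ p B Ys cube γ X hΔ hm hΔm hs hek ht h1 hΦ hc hV K τ₀ hΛ hframe hD ha
    (prec blk Δ X s)⁻¹ N Lt hA hA1 hw hχ hY).trans (sum_le_sum fun E _ => sum_le_sum fun g _ =>
      mul_le_mul_of_nonneg_right (mul_le_mul_of_nonneg_right ?_ ?_) ?_)
  · exact abs_trainCoef_le (f := src blk ℱ X) (fun k x y => hκ (Lt.get k) x y) (fun q => hFq q) E
  · exact prod_nonneg fun τ _ => mul_nonneg (hA _ _ _) (prod_nonneg fun j _ => hw _ _)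
  · exact prod_nonneg fun b _ => mul_nonneg zero_le_two (Real.exp_nonneg _)

/-! ## §3  THE MASTER BOUND without `‖ℱ|_X″‖₂` -/

section Master

variable (adj : I → I → Prop) [DecidableRel adj] (Λc : Finset I)

/-- **THE MASTER BOUND OF `g₃(H, X″)`, `|X″| ≥ 2`, SIZE-FREE SOURCE CLASS**: as `BIJ88LocatedActivityBound309.abs_actIn_le_master`, with the
Gaussian shells `2e^{−a_b(a_b − 2Λ_∞(2/m)F₀Z)/(2Λ²/m)}` — the drift of every located χ-slot bounded, uniformly in `|X″|` and in `s ∈ [0,1]^I`, by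
`BIJ88SlotDriftLetter309.abs_slotField_drift_le` from the `Δ`-letters, the sitewise source bound `F₀` on the sites of `X″`, the site lattice sum
`Z` and the ℓ^∞ slot letter `Λ_∞` (p. 307 L11–13: the χ-factors near the source see it only through *"the exponential decay of the operators C_s
and Δ"*). [cite: BalabanImbrieJaffe1988, (5.14.4) p.309; §5.13 p.306–307] -/
theorem abs_actIn_le_master_sizeFree (hΔ : Δ.PosDef) {m C₀ : ℝ} (hm : 0 < m)
    (hΔm : ∀ φ : α → ℝ, m * (φ ⬝ᵥ φ) ≤ φ ⬝ᵥ (Δ *ᵥ φ)) (hCΔ : ∀ v, v ⬝ᵥ (Δ *ᵥ v) ≤ C₀ * (v ⬝ᵥ v))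
    (hek : 0 < ek) (ht : 0 < t) (h1 : t * ek < 1) (hΦ : ∀ b ∈ B, IsLinearMap ℝ (Φ b)) (hc : ∀ b ∈ B, c b ≠ 0)
    (hV : ∀ Y ∈ Ys, CbInf (V Y))
    (X : Finset I) {S : Type*} [DecidableEq S] (γ' : S → ↥(slotB B Ys cube X) ⊕ ↥(slotY B Ys cube X)) (H : Finset S)
    {X'' : Finset I} (h2 : 2 ≤ X''.card) (hXs : ∃ x, blk x ∈ X'') (τ₀ : ↥(slotB B Ys cube X) ⊕ ↥(slotY B Ys cube X))
    {Λ : ℝ} (hΛ : 0 < Λ)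
    (hframe : ∀ (θ : ↥(univ.filter fun b : ↥(slotB B Ys cube X) => cubeIn cube X (Sum.inl b) ∈ X'') → ℝ) (φ : α → ℝ),
      |∑ b, θ b * Φ b.1.1 φ| ≤ Λ * Real.sqrt (∑ b, θ b ^ 2) * Real.sqrt (φ ⬝ᵥ φ))
    -- the `Δ`-letters, the sitewise source, the site lattice sum and the ℓ^∞ slot letter (in place of `‖ℱ|_X″‖₂ ≤ F`)
    (d : α → α → ℝ) (hd0 : ∀ i, d i i = 0) (hdsymm : ∀ i k, d i k = d k i)
    (hdtri : ∀ i j k, d i k ≤ d i j + d j k) (hband : ∀ x y, 1 < d x y → Δ x y = 0) {h : ℝ} (hh0 : 0 ≤ h)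
    (hh : ∀ x y, x ≠ y → |Δ x y| ≤ h) {z : ℝ} (hz : ∀ x, ((univ.filter fun y => y ≠ x ∧ d x y ≤ 1).card : ℝ) ≤ z) {μ : ℝ} (hμ : 0 ≤ μ)
    (hsmall : h * z * (Real.exp μ - 1) ≤ m / 2) {F₀ : ℝ} (hF₀ : 0 ≤ F₀) (hℱ : ∀ y : BIJ88PolymerRep5134Gauss.Site blk X'', |ℱ y.1| ≤ F₀)
    {Z : ℝ} (hZ0 : 0 ≤ Z)
    (hZ : ∀ y' : BIJ88PolymerRep5134Gauss.Site blk X'', ∑ y : BIJ88PolymerRep5134Gauss.Site blk X'', Real.exp (-(μ / 2 * d y'.1 y.1)) ≤ Z)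
    {Λinf : ℝ} (hΦinf : ∀ b : ↥(slotB B Ys cube X), ∀ (φ : α → ℝ) (M : ℝ), 0 ≤ M → (∀ x, |φ x| ≤ M) → |Φ b.1 φ| ≤ Λinf * M)
    {a a' : ↥(slotB B Ys cube X) → ℝ} (ha : ∀ b, 0 ≤ a b)
    {A : ↥(slotB B Ys cube X) ⊕ ↥(slotY B Ys cube X) → ℕ → ℕ → ℝ} (hA : ∀ τ m n, 0 ≤ A τ m n)
    (hA1 : ∀ b : ↥(slotB B Ys cube X), 1 ≤ A (Sum.inl b) 0 0)
    {w : ↥(slotB B Ys cube X) ⊕ ↥(slotY B Ys cube X) → BIJ88PolymerRep5134Gauss.Site blk X'' → ℝ} (hw : ∀ τ x, 0 ≤ w τ x)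
    (hχ : ∀ (κ : Type) [LinearOrder κ] (q : κ → BIJ88PolymerRep5134Gauss.Site blk X'') (b : ↥(slotB B Ys cube X)) (m : ℕ)
      (D' : Finset κ) (φ : BIJ88PolymerRep5134Gauss.Site blk X'' → ℝ), (m ≠ 0 ∨ D'.card ≠ 0) →
      |dset (fun j => Pi.single (q j) (1 : ℝ)) D'
        (fun ψ => uD χ p ek (slotB B Ys cube X) (fun b : ↥B => Φ b) (fun b : ↥B => c b) (slotY B Ys cube X) (fun Y : ↥Ys => V Y) t
          (Sum.inl b) m (ext blk X'' ψ)) φ| ≤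
        A (Sum.inl b) m D'.card * (∏ j ∈ D', w (Sum.inl b) (q j)) *
          Set.indicator (Set.Icc (a b) (a' b)) (fun _ => (1 : ℝ)) |Φ b.1 (ext blk X'' φ)|)
    (hY : ∀ (κ : Type) [LinearOrder κ] (q : κ → BIJ88PolymerRep5134Gauss.Site blk X'') (Y : ↥(slotY B Ys cube X)) (m : ℕ)
      (D' : Finset κ) (φ : BIJ88PolymerRep5134Gauss.Site blk X'' → ℝ),
      |dset (fun j => Pi.single (q j) (1 : ℝ)) D'
        (fun ψ => uD χ p ek (slotB B Ys cube X) (fun b : ↥B => Φ b) (fun b : ↥B => c b) (slotY B Ys cube X) (fun Y : ↥Ys => V Y) t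
          (Sum.inr Y) m (ext blk X'' ψ)) φ| ≤
        A (Sum.inr Y) m D'.card * ∏ j ∈ D', w (Sum.inr Y) (q j))
    {κc : Finset (Finset I) → BIJ88PolymerRep5134Gauss.Site blk X'' → BIJ88PolymerRep5134Gauss.Site blk X'' → ℝ}
    (hκ : ∀ s : I → ℝ, (∀ i, 0 ≤ s i ∧ s i ≤ 1) → ∀ (cg : Finset (Finset I)) (x y : BIJ88PolymerRep5134Gauss.Site blk X''),
      |((prec blk (interpForm blk Δ (corner ℝ Λc)) X'' s)⁻¹ *
          wker (prec blk (interpForm blk Δ (corner ℝ Λc)) X'' s)⁻¹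
            (fun b => bmat (fun x : BIJ88PolymerRep5134Gauss.Site blk X'' => blk x.1)
                ((interpForm blk Δ (corner ℝ Λc)).submatrix Subtype.val Subtype.val) s b
              + (bmat (fun x : BIJ88PolymerRep5134Gauss.Site blk X'' => blk x.1)
                ((interpForm blk Δ (corner ℝ Λc)).submatrix Subtype.val Subtype.val) s b)ᵀ) cg) x y| ≤ κc cg x y)
    {Fq : BIJ88PolymerRep5134Gauss.Site blk X'' → ℝ} (hFq : ∀ q : BIJ88PolymerRep5134Gauss.Site blk X'', |ℱ q.1| ≤ Fq q) :
    |actIn blk Δ ℱ adj χ p ek B Φ c Ys V cube Λc X t γ' H X''| ≤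
      ∑ σ ∈ smallParts X'', ∑ P ∈ setPartitions σ,
        ∑ E : Fin P.toList.length → BIJ88PolymerRep5134Gauss.Site blk X'' ⊕
            (BIJ88PolymerRep5134Gauss.Site blk X'' × BIJ88PolymerRep5134Gauss.Site blk X''),
          ∑ g ∈ Fintype.piFinset (fun j => if j ∈ trainLegs E then univ.filter (fun τ => cubeIn cube X τ ∈ X'') else {τ₀}),
            (∏ k, Sum.elim (fun x => ∑ y, κc (P.toList.get k) x y * Fq y)
                (fun xy => (1 / 2 : ℝ) * κc (P.toList.get k) xy.1 xy.2) (E k)) *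
              (∏ τ ∈ univ.filter (fun τ => cubeIn cube X τ ∈ X''),
                (A τ (H.filter fun j => γ' j = τ).card ((trainLegs E).filter fun j => g j = τ).card *
                  ∏ j ∈ (trainLegs E).filter (fun j => g j = τ), w τ (trainSite E j))) *
              ∏ b ∈ (univ.filter fun b : ↥(slotB B Ys cube X) => cubeIn cube X (Sum.inl b) ∈ X'').attach.filter (fun b =>
                  (H.filter fun j => γ' j = Sum.inl b.1).card ≠ 0 ∨ ((trainLegs E).filter fun j => g j = Sum.inl b.1).card ≠ 0),
                2 * Real.exp (-(a b.1 * (a b.1 - 2 * (Λinf * (2 / m * F₀ * Z))) / (2 * (Λ ^ 2 / m)))) := by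
  have hcube : ∀ i, 0 ≤ corner ℝ Λc i ∧ corner ℝ Λc i ≤ 1 := BIJ88ActivityWalkBound309.corner_mem_cube Λc
  have hΔ' : (interpForm blk Δ (corner ℝ Λc)).PosDef := BIJ88DirichletForms305.interpForm_posDef blk hΔ hcube
  have hΔm' : ∀ φ : α → ℝ, m * (φ ⬝ᵥ φ) ≤ φ ⬝ᵥ (interpForm blk Δ (corner ℝ Λc) *ᵥ φ) :=
    fun φ => BIJ88DirichletForms305.quadForm_interpForm_ge blk hΔm hcube φ
  have hκ0 : ∀ cg x y, 0 ≤ κc cg x y := fun cg x y =>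
    (abs_nonneg _).trans (hκ (fun _ => 0) (fun _ => ⟨le_rfl, zero_le_one⟩) cg x y)
  have hFq0 : ∀ y, 0 ≤ Fq y := fun y => (abs_nonneg _).trans (hFq y)
  refine abs_actIn_le_sum blk Δ ℱ adj χ cube Λc hΔ hm hΔm hCΔ hek ht h1 hΦ hc hV X γ' H h2 hXs
    (fun σ _ P _ => sum_nonneg fun E _ => sum_nonneg fun g _ => mul_nonneg (mul_nonneg
      (prod_nonneg fun k _ => sum_elim_nonneg (fun x => sum_nonneg fun y _ => mul_nonneg (hκ0 _ x y) (hFq0 y))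
        (fun xy => mul_nonneg (by norm_num) (hκ0 _ _ _)) (E k))
      (prod_nonneg fun τ _ => mul_nonneg (hA _ _ _) (prod_nonneg fun j _ => hw _ _)))
      (prod_nonneg fun b _ => mul_nonneg zero_le_two (Real.exp_nonneg _)))
    fun s hs σ _ P _ => ?_
  exact abs_gexp_trains_fD_uD_le_of_cert_local blk (interpForm blk Δ (corner ℝ Λc)) ℱ χ p (slotB B Ys cube X) (slotY B Ys cube X)
    (cubeIn cube X) γ' X'' hΔ' hm hΔm' hs hek ht h1 (fun b _ => hΦ b.1 b.2) (fun b _ => hc b.1 b.2) (fun Y _ => hV Y.1 Y.2)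
    H τ₀ hΛ hframe (fun b => abs_slotField_drift_le blk Δ ℱ d hd0 hdsymm hdtri hband hh0 hh hz hΔ hm hΔm hμ hsmall Λc X'' hs hF₀ hℱ hZ0
      hZ (hΦinf b.1)) ha _ P.toList hA hA1 hw (fun q b m D' φ hmn => hχ _ q b m D' φ hmn) (fun q Y m D' φ => hY _ q Y m D' φ)
    (hκ s hs) hFq

end Master

end Literature.MathematicalPhysics.QuantumFieldTheory.BalabanImbrieJaffe1984to88.BIJ88LocatedActivityBoundSizeFree309
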